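import Mathlib
import HarnessLib
import Summits.CriticalPhenomena.SAWScalingLimit.Theses.SAWStressTensor
import Literature.Probability.RandomPlanarGeometry.EdgeFugacitySAW

/-!
# Birth skeleton for the crux `SAWStressTensor.SlitQuadrupoleShape` (stmt-CriticalPhenomena-7751)

Route `route-CriticalPhenomena-SAWStressTensor` (sub-problem `SAWScalingLimit`), crux #3 (rank 3)
`SlitQuadrupoleShape` — the MARTINGALE-READY, lattice-intrinsic form of the stress-tensor shape claim:
there are amplitudes `A₁ A₂ : ℝ → ℝ` (mesh only) such that for every Dobrushin domain `(Ω; a, b)`,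
endpoint approximation `(a_δ, b_δ)`, `ε, ρ > 0` and all small `δ`, for EVERY self-avoiding prefix `η`
of positive `SAW.law`-probability from `a_δ` to a tip `v` and every site `z` that is `ρ`-inside `Ω`,
`ρ`-away from `b_δ` and from `η`:
`|E[X₁(z) | γ extends η]/A₁(δ) − Re (D_z L)²| ≤ ε` and `|E[X₂(z) | γ extends η]/A₂(δ) − Im (D_z L)²| ≤ ε`,
where `X₁ = 𝟙{straight horizontal passage at z} − 𝟙{straight vertical passage}` (D4 axis quadrupole,
`~ T_xx − T_yy`), `X₂ = 𝟙{NE or SW turn at z} − 𝟙{NW or SE turn}` (diagonal quadrupole, `~ T_xy`), and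
`L = log (G_η(·, b_δ)/G_η(·, v))` is the log-ratio of the two Green functions of simple random walk
killed on leaving `Ω_δ ∖ (η ∖ {v})`, `D_z` the discrete `∂_z` — the random-walk form of `(ψ_η′/ψ_η)²`.
Registered by the skeleton registrar `planner-skel-stmt-CriticalPhenomena-7751-0` (2026-08-17; route
re-audit bin REPAIRABLE); published as `Cruxes/SlitQuadrupoleShape/Lines/birth.lean`.

## The line in one paragraph — "uncondition first, then one channel at a time"

The conditional expectation in the crux is an expectation for ANOTHER critical SAW: by the **domain
Markov property of the weight `x_c^{|γ|}`** (`|η.append q| = |η| + |q|`, so the factor `x_c^{|η|}`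
cancels on normalisation; `q ↦ η.append q` is a bijection between the self-avoiding walks of
`Ω_δ` from the tip `v` to `b_δ` avoiding `η ∖ {v}` and the SAWs of `Ω_δ` extending `η`; and the four
edges at `z ∉ η` belong to the continuation `q`), the law of the remainder of `γ` given
`{γ extends η}` is the tree's **restricted edge-fugacity law**
`SAW.edgeFugacityLaw Ω_δ (fun _ _ ↦ x_c) (η.support ∖ {v})ᶜ v b_δ` on `SAW.RestrictedSAW`
(`Literature/Probability/RandomPlanarGeometry/EdgeFugacitySAW.lean`, Grimmett–Li weighted SAWs). This
is stub **DM** (`stub_domainMarkov`, size M, PROVABLE NOW, exact identity at every fixed `δ > 0`).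
What is left is a ONE-POINT FUNCTION problem for an UNCONDITIONED critical SAW in the rough discrete
slit domain `Ω_δ ∖ (η ∖ {v})` between two of its boundary-attached vertices (`v` is adjacent to the
deleted slit, `b_δ` is near `∂Ω`) — exactly the setting of the prefix-free headline crux
`QuadrupoleShape`, generalised from `Ω_δ` to its slit sub-domains with ONE amplitude for all of them
(the local-limit / operator-renormalisation content à la Beneš–Lawler–Viklund for the LERW Green's
function). It is registered channel by channel, because the two D4 channels are different lattice
observables with different amplitudes and possibly different corrections (the route's own CHEAPEST
FALSIFIER and KILL CRITERIA are per channel: "B1 or B2"): stub **B1** (`stub_slitShapeB1`, axis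
quadrupole ↔ `Re`, OPEN) and stub **B2** (`stub_slitShapeB2`, diagonal quadrupole ↔ `Im`, OPEN), each
keeping EVERY hypothesis of the crux verbatim (endpoint approximation, `η.IsPath`, positivity of the
extension event, the three `ρ`-conditions) and each with its own amplitude `∃ Aᵢ : ℝ → ℝ` outermost.

  SlitQuadrupoleShape ⇐ DM ∧ B1 ∧ B2 :
    `A₁` from B1, `A₂` from B2; for `(D, a, b)`, `ε`, `ρ`: eventually in `δ` (B1-event ∧ B2-event ∧
    `δ > 0`); `z ∉ η.support` from the third `ρ`-condition (`dist = 0 < ρ`); rewrite both conditional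
    expectations by DM; done.

`SlitQuadrupoleShape_of` (no `sorry`) composes the three registered stubs and concludes the crux BY
NAME (`Summit.CriticalPhenomena.SAWScalingLimit.Theses.SAWStressTensor.SlitQuadrupoleShape`); its
hypotheses are the name-keyed aliases `Registered.stub_*` (device of
`Cruxes/SubCurvatureTightness/Lines/birth.lean`, `Cruxes/ShellCrossingBound/Lines/pinch-on-a-circle.lean`).
Two PROVED rungs of DM are included (`mem_edges_append_iff_of_notMem_left/right`: the edges at a
vertex off the prefix are edges of the continuation).

## Why this cut and not another (registrar's note)

* The crux is typed on the lattice precisely to avoid a continuum slit map (an interior `a_δ` makes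
  `Ω ∖ η` doubly connected; `b_δ` is an interior point), so the natural analytic split "SAW one-point
  shape = continuum `h(ψ′/ψ)²`" + "RW log-gradient → `ψ′/ψ` uniformly in rough slits (Kozdron–Lawler)"
  would need a continuum Green/Martin-kernel object for arbitrary Greenian slit domains that the tree
  does not have; it is recorded as the foreseen LAYER-2 split of B1/B2 (see their docstrings), not typed.
* Generalising B1/B2 from SAW-prefix slits to arbitrary deleted vertex sets `K` was rejected: for porous
  `K` the continuum domain is multiply connected and the two-pole shape `(∂ log G_b/G_v)²` is NOT the
  stress-tensor one-point function (moduli contribute) — a more general stub would be more likely false.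

## BC3 audit (registrar, 2026-08-17; raw outputs in the registrar's NOTES.md `birth-certificate:`)

* `lean check --json` of this file: rc 0, errors [], sorries = 3 = stubs (`stub_domainMarkov`,
  `stub_slitShapeB1`, `stub_slitShapeB2`), zero elsewhere (`SlitQuadrupoleShape_of`, the `_holds`
  certificates, the two rungs and the wiring `example` are sorry-free; the composition's only
  non-whitelisted axiom is the stubs' `sorryAx` through the wiring example, not through
  `SlitQuadrupoleShape_of`).
* Probes (`bc/probe_<stub>_split.lean`; context = this file's imports, stubs NOT in scope;
  `set_option maxHeartbeats 400000`; tactics `exact?`, `simpa`, `simpa [S]`, `(unfold S; simpa)`,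
  `aesop`, one example each): for each of the three stub statements `S`, `S → SlitQuadrupoleShape`
  FAILS and `S → _root_.SAWScalingLimit` FAILS under every tactic (30/30 failures: `exact?` "could
  not close the goal", `simpa`/`unfold; simpa` "assumption failed", `simpa [S]` heartbeat time-out or
  failure, `aesop` "failed to prove the goal after exhaustive search"). No stub is cheaply the crux or
  the summit: DM is a fixed-`δ` identity with no amplitude and no limit; B1 (resp. B2) controls one
  channel only and speaks of the UNCONDITIONED slit law, so even B1 ∧ B2 needs DM to reach the crux.

## Disproof used / negatives

No `Cruxes/SlitQuadrupoleShape/Disproof.lean`, no `Lines/*`, no `Theorems/SlitQuadrupoleShape/Negative/*`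
existed at registration (`ledger crux ls stmt-CriticalPhenomena-7751`: no workfiles). `ledger negatives
--problem CriticalPhenomena` (11 entries): none concerns occupation-pattern densities, conditional SAW
laws or killed-walk Green functions; the nearby SAW negative stmt-CriticalPhenomena-0772 (ALL-`δ`
tightness) is not touched — DM is a fixed-`δ` identity and B1/B2 are EVENTUAL in `δ` (`∀ᶠ δ in 𝓝[>] 0`),
exactly as the crux.

## References

DoyonRivaCardy2006 (arXiv:math-ph/0511054) Thm 2.1; BenesLawlerViklund2015 (arXiv:1402.7345);
KozdronLawler2005; KennedyLawler2013; LawlerSchrammWerner2004SAW §3.4.2 (domain Markov / restriction of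
`μ^{-|ω|}`); DuminilCopinSmirnov2012Clay Prop. 6.7; GrimmettLi2019 §2 (weighted/restricted SAW laws —
tree `EdgeFugacitySAW.lean`); MadrasSlade1993 §1.2.
-/

noncomputable section

open scoped BigOperators Topology Manifold Classical MeasureTheory ProbabilityTheory Matrix InnerProductSpace ComplexConjugate ContinuousMap
open Filter Set MeasureTheory
open Literature.Probability.RandomPlanarGeometry Literature.Probability.LatticeModels
open Summit.CriticalPhenomena.SAWScalingLimit.Theses.SAWStressTensor (SlitQuadrupoleShape)

namespace Summit.CriticalPhenomena.SAWScalingLimit.Cruxes.SlitQuadrupoleShape.Birth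

/-! ## §0 The three statements, named (documentation; each stub of §1 restates its body verbatim) -/

/-- **(DM) Domain Markov property of the critical SAW, for the two quadrupole densities** (size M,
PROVABLE NOW). For a Dobrushin domain `D`, a mesh `δ > 0`, lattice endpoints `a₀ b₀`, a self-avoiding
prefix `η` of `Ω_δ = discreteDomainGraph D.carrier δ` from `a₀` to a tip `v` whose extension event
`Xη = {γ | γ.walk = η.append q for some q}` has positive `SAW.law`-probability, and a site `z ∉ η`:
the conditional expectation given `Xη` (restricted integral divided by the mass of `Xη`) of the axis
quadrupole density `X₁(z)` (resp. the diagonal density `X₂(z)`) under `SAW.law D.carrier δ a₀ b₀`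
EQUALS the plain expectation of the same density of `q` under the restricted critical edge-fugacity law
`SAW.edgeFugacityLaw Ω_δ (fun _ _ ↦ x_c) (η.support ∖ {v})ᶜ v b₀` (SAWs of `Ω_δ` from `v` to `b₀`
avoiding `η ∖ {v}`, weight `x_c^{#edges}`, normalised). Proof route: `q ↦ ⟨η.append q, _⟩` is a
bijection `RestrictedSAW Ω_δ (η.support ∖ {v})ᶜ v b₀ ≃ Xη` (`Walk.isPath` of an append: `η` path, `q`
path, `q.support.tail ∩ η.support = ∅`); weights factor, `x_c^{|η.append q|} = x_c^{|η|} · x_c^{|q|}`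
(`dartWeight_const`, `Walk.length_append`), and `x_c^{|η|} ≠ 0` because `Xη` has positive mass; both
sides are finite weighted sums (`D.isBounded`, `meshVertices_finite`, `RestrictedSAW.finite`); the
integrands agree along the bijection by `mem_edges_append_iff_of_notMem_left/right` (`z ∉ η.support`).
Degenerate case `x_c = 0` is consistent (both sides reduce to the trivial walk). [LawlerSchrammWerner2004SAW
§3.4.2; DuminilCopinSmirnov2012Clay §6; GrimmettLi2019 §2] -/
def DomainMarkov : Prop :=
  ∀ (D : DobrushinDomain) (δ : ℝ) (a₀ b₀ v : Site 2)
    (η : (discreteDomainGraph D.carrier δ).Walk a₀ v), 0 < δ → η.IsPath →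
    0 < (SAW.law D.carrier δ a₀ b₀).real
      {γ | ∃ q : (discreteDomainGraph D.carrier δ).Walk v b₀, γ.walk = η.append q} →
    ∀ z : Site 2, z ∉ η.support →
      let G := discreteDomainGraph D.carrier δ
      let S : Set (Site 2) := {w | w ∈ η.support ∧ w ≠ v}
      let Xη : Set (SAW.DomainSAW D.carrier δ a₀ b₀) := {γ | ∃ q : G.Walk v b₀, γ.walk = η.append q}
      let P' := SAW.edgeFugacityLaw G (fun _ _ => SAW.criticalFugacity) Sᶜ v b₀
      (∫ γ in Xη, ((if s(z - ![1, 0], z) ∈ γ.walk.edges ∧ s(z, z + ![1, 0]) ∈ γ.walk.edges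
            then (1 : ℝ) else 0) -
          (if s(z - ![0, 1], z) ∈ γ.walk.edges ∧ s(z, z + ![0, 1]) ∈ γ.walk.edges
            then (1 : ℝ) else 0)) ∂(SAW.law D.carrier δ a₀ b₀)) /
          (SAW.law D.carrier δ a₀ b₀).real Xη =
        ∫ (q : SAW.RestrictedSAW G Sᶜ v b₀),
          ((if s(z - ![1, 0], z) ∈ q.walk.edges ∧ s(z, z + ![1, 0]) ∈ q.walk.edges
              then (1 : ℝ) else 0) -
            (if s(z - ![0, 1], z) ∈ q.walk.edges ∧ s(z, z + ![0, 1]) ∈ q.walk.edges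
              then (1 : ℝ) else 0)) ∂P' ∧
      (∫ γ in Xη, ((if (s(z, z + ![1, 0]) ∈ γ.walk.edges ∧ s(z, z + ![0, 1]) ∈ γ.walk.edges) ∨
              (s(z - ![1, 0], z) ∈ γ.walk.edges ∧ s(z - ![0, 1], z) ∈ γ.walk.edges)
            then (1 : ℝ) else 0) -
          (if (s(z - ![1, 0], z) ∈ γ.walk.edges ∧ s(z, z + ![0, 1]) ∈ γ.walk.edges) ∨
              (s(z, z + ![1, 0]) ∈ γ.walk.edges ∧ s(z - ![0, 1], z) ∈ γ.walk.edges)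
            then (1 : ℝ) else 0)) ∂(SAW.law D.carrier δ a₀ b₀)) /
          (SAW.law D.carrier δ a₀ b₀).real Xη =
        ∫ (q : SAW.RestrictedSAW G Sᶜ v b₀),
          ((if (s(z, z + ![1, 0]) ∈ q.walk.edges ∧ s(z, z + ![0, 1]) ∈ q.walk.edges) ∨
                (s(z - ![1, 0], z) ∈ q.walk.edges ∧ s(z - ![0, 1], z) ∈ q.walk.edges)
              then (1 : ℝ) else 0) -
            (if (s(z - ![1, 0], z) ∈ q.walk.edges ∧ s(z, z + ![0, 1]) ∈ q.walk.edges) ∨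
                (s(z, z + ![1, 0]) ∈ q.walk.edges ∧ s(z - ![0, 1], z) ∈ q.walk.edges)
              then (1 : ℝ) else 0)) ∂P'

/-- **(B1) Slit one-point shape — AXIS channel** (`X₁ ~ T_xx − T_yy ↔ Re`, OPEN; the analytic heart,
half of it). There is ONE amplitude `A₁ : ℝ → ℝ` (mesh only) such that for every Dobrushin domain,
endpoint approximation, `ε, ρ > 0` and all small `δ`, for every self-avoiding prefix `η : a_δ → v` with
positive extension probability and every site `z` that is `ρ`-inside `Ω` and `ρ`-away from `b_δ` and
from `η`: the expectation of the axis quadrupole density at `z` under the UNCONDITIONED restricted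
critical law `SAW.edgeFugacityLaw Ω_δ (fun _ _ ↦ x_c) (η.support ∖ {v})ᶜ v b_δ` (critical SAW in the
slit domain `Ω_δ ∖ (η ∖ {v})` from the tip to `b_δ`), divided by `A₁ δ`, is within `ε` of
`Re (D_z L)²`, `L = log (G_η(·, b_δ)/G_η(·, v))` the log-ratio of killed-SRW Green functions on the
slit graph (verbatim the crux's `Gf`, `Gη`, `L`, `DL`). Why it might fail: as the crux — uniformity
over ALL rough lattice slits with one amplitude is a local-limit statement beyond the scaling limit
(proved only for the LERW vertex function, BLV 2015); doubly connected slit domains for interior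
`a_δ`; the `c = 0` log-partner makes corrections decay like `1/log(1/δ)`. Foreseen layer-2 split (not
typed: needs continuum Green/Martin kernels of Greenian slit domains): (i) the normalised axis
quadrupole one-point function is within `o(1)` of `Re S_U(z)`, `S_U := (∂_z log (G_U(·, b_δ)/M_U(·, v)))²`,
`G_U` the Dirichlet Green function of the continuum slit domain `U = Ω ∖ η̂` with pole at the interior
point `b_δ` and `M_U(·, v)` its Martin kernel at the tip (for simply connected `U` and `b_δ → b ∈ ∂Ω`
this is Doyon–Riva–Cardy's `(ψ′/ψ)²` with the weight `h` divided out); (ii) `D_z L → ∂_z log (G_U/M_U)`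
uniformly over rough lattice slits (Kozdron–Lawler 2005 toolbox).
[DoyonRivaCardy2006 Thm 2.1; BenesLawlerViklund2015; KozdronLawler2005; KennedyLawler2013] -/
def SlitShapeB1 : Prop :=
  ∃ A₁ : ℝ → ℝ, ∀ (D : DobrushinDomain) (a b : ℝ → Site 2), SAW.IsEndpointApprox D a b →
    let Gf : SimpleGraph (Site 2) → Site 2 → Site 2 → ℝ := fun Gr p q =>
      ∑' n : ℕ, (SRW.pathLaw 2).real {ω | (∀ j < n, Gr.Adj (p + SRW.S ω j) (p + SRW.S ω (j + 1))) ∧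
        p + SRW.S ω n = q}
    ∀ ε > (0 : ℝ), ∀ ρ > (0 : ℝ), ∀ᶠ δ in nhdsWithin 0 (Set.Ioi 0),
      ∀ (v : Site 2) (η : (discreteDomainGraph D.carrier δ).Walk (a δ) v), η.IsPath →
        0 < (SAW.law D.carrier δ (a δ) (b δ)).real
          {γ | ∃ q : (discreteDomainGraph D.carrier δ).Walk v (b δ), γ.walk = η.append q} →
        ∀ (z : Site 2), ρ ≤ Metric.infDist (meshPoint δ z) D.carrierᶜ →
          ρ ≤ dist (meshPoint δ z) (meshPoint δ (b δ)) →
          (∀ w ∈ η.support, ρ ≤ dist (meshPoint δ z) (meshPoint δ w)) →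
          let G := discreteDomainGraph D.carrier δ
          let S : Set (Site 2) := {w | w ∈ η.support ∧ w ≠ v}
          let Gη : SimpleGraph (Site 2) := SimpleGraph.fromRel (fun x y => G.Adj x y ∧ x ∉ S ∧ y ∉ S)
          let E₁ : ℝ := ∫ (q : SAW.RestrictedSAW G Sᶜ v (b δ)),
            ((if s(z - ![1, 0], z) ∈ q.walk.edges ∧ s(z, z + ![1, 0]) ∈ q.walk.edges
                then (1 : ℝ) else 0) -
              (if s(z - ![0, 1], z) ∈ q.walk.edges ∧ s(z, z + ![0, 1]) ∈ q.walk.edges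
                then (1 : ℝ) else 0))
            ∂(SAW.edgeFugacityLaw G (fun _ _ => SAW.criticalFugacity) Sᶜ v (b δ))
          let L : Site 2 → ℝ := fun p => Real.log (Gf Gη p (b δ) / Gf Gη p v)
          let DL : ℂ := (((L (z + ![1, 0]) - L (z - ![1, 0]) : ℝ) : ℂ) -
            Complex.I * ((L (z + ![0, 1]) - L (z - ![0, 1]) : ℝ) : ℂ)) / (4 * δ)
          |E₁ / A₁ δ - (DL ^ 2).re| ≤ ε

/-- **(B2) Slit one-point shape — DIAGONAL channel** (`X₂ ~ T_xy ↔ Im`, OPEN; the other half of the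
analytic heart). As B1 with the diagonal quadrupole density `X₂ = 𝟙{NE or SW turn at z} − 𝟙{NW or SE
turn at z}`, its own amplitude `A₂`, and `Im (D_z L)²`. Registered separately from B1: a different
lattice observable (turns, not straight passages), a different amplitude, and the route's cheapest
falsifier / kill criteria are stated per channel; either channel may fail alone (e.g. by coupling more
strongly to a lattice-symmetric irrelevant operator). [DoyonRivaCardy2006 Thm 2.1; Cardy2013;
BenesLawlerViklund2015; KozdronLawler2005] -/
def SlitShapeB2 : Prop :=
  ∃ A₂ : ℝ → ℝ, ∀ (D : DobrushinDomain) (a b : ℝ → Site 2), SAW.IsEndpointApprox D a b →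
    let Gf : SimpleGraph (Site 2) → Site 2 → Site 2 → ℝ := fun Gr p q =>
      ∑' n : ℕ, (SRW.pathLaw 2).real {ω | (∀ j < n, Gr.Adj (p + SRW.S ω j) (p + SRW.S ω (j + 1))) ∧
        p + SRW.S ω n = q}
    ∀ ε > (0 : ℝ), ∀ ρ > (0 : ℝ), ∀ᶠ δ in nhdsWithin 0 (Set.Ioi 0),
      ∀ (v : Site 2) (η : (discreteDomainGraph D.carrier δ).Walk (a δ) v), η.IsPath →
        0 < (SAW.law D.carrier δ (a δ) (b δ)).real
          {γ | ∃ q : (discreteDomainGraph D.carrier δ).Walk v (b δ), γ.walk = η.append q} →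
        ∀ (z : Site 2), ρ ≤ Metric.infDist (meshPoint δ z) D.carrierᶜ →
          ρ ≤ dist (meshPoint δ z) (meshPoint δ (b δ)) →
          (∀ w ∈ η.support, ρ ≤ dist (meshPoint δ z) (meshPoint δ w)) →
          let G := discreteDomainGraph D.carrier δ
          let S : Set (Site 2) := {w | w ∈ η.support ∧ w ≠ v}
          let Gη : SimpleGraph (Site 2) := SimpleGraph.fromRel (fun x y => G.Adj x y ∧ x ∉ S ∧ y ∉ S)
          let E₂ : ℝ := ∫ (q : SAW.RestrictedSAW G Sᶜ v (b δ)),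
            ((if (s(z, z + ![1, 0]) ∈ q.walk.edges ∧ s(z, z + ![0, 1]) ∈ q.walk.edges) ∨
                  (s(z - ![1, 0], z) ∈ q.walk.edges ∧ s(z - ![0, 1], z) ∈ q.walk.edges)
                then (1 : ℝ) else 0) -
              (if (s(z - ![1, 0], z) ∈ q.walk.edges ∧ s(z, z + ![0, 1]) ∈ q.walk.edges) ∨
                  (s(z, z + ![1, 0]) ∈ q.walk.edges ∧ s(z - ![0, 1], z) ∈ q.walk.edges)
                then (1 : ℝ) else 0))
            ∂(SAW.edgeFugacityLaw G (fun _ _ => SAW.criticalFugacity) Sᶜ v (b δ))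
          let L : Site 2 → ℝ := fun p => Real.log (Gf Gη p (b δ) / Gf Gη p v)
          let DL : ℂ := (((L (z + ![1, 0]) - L (z - ![1, 0]) : ℝ) : ℂ) -
            Complex.I * ((L (z + ![0, 1]) - L (z - ![0, 1]) : ℝ) : ℂ)) / (4 * δ)
          |E₂ / A₂ δ - (DL ^ 2).im| ≤ ε

/-! ## §1 Two proved rungs of DM: the edges at a vertex off the prefix belong to the continuation -/

section Rungs

variable {V : Type*} {G : SimpleGraph V} {u v w x z : V}

/-- For `z ∉ η.support`, an edge `s(x, z)` of `η.append q` is an edge of `q` (an edge of `η` would put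
`z` on `η`). [folklore] -/
theorem mem_edges_append_iff_of_notMem_right (η : G.Walk u v) (q : G.Walk v w)
    (hz : z ∉ η.support) : s(x, z) ∈ (η.append q).edges ↔ s(x, z) ∈ q.edges := by
  rw [SimpleGraph.Walk.edges_append, List.mem_append]
  exact ⟨fun h => h.elim (fun h' => (hz (η.snd_mem_support_of_mem_edges h')).elim) id, Or.inr⟩

/-- For `z ∉ η.support`, an edge `s(z, x)` of `η.append q` is an edge of `q`. [folklore] -/
theorem mem_edges_append_iff_of_notMem_left (η : G.Walk u v) (q : G.Walk v w)
    (hz : z ∉ η.support) : s(z, x) ∈ (η.append q).edges ↔ s(z, x) ∈ q.edges := by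
  rw [SimpleGraph.Walk.edges_append, List.mem_append]
  exact ⟨fun h => h.elim (fun h' => (hz (η.fst_mem_support_of_mem_edges h')).elim) id, Or.inr⟩

end Rungs

/-! ## §2 The registered stubs (`sorry` lives ONLY in these three theorems; each restates its named
statement verbatim over tree declarations, `*_holds` below certify the agreement definitionally) -/

/-- **STUB DM · `stub_domainMarkov`** (M, PROVABLE NOW) `= DomainMarkov`: the conditional law of the
critical SAW given that it extends the prefix `η` is the restricted critical edge-fugacity law from the
tip, read on the two quadrupole densities at any `z ∉ η`. -/
theorem stub_domainMarkov :
    ∀ (D : DobrushinDomain) (δ : ℝ) (a₀ b₀ v : Site 2)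
      (η : (discreteDomainGraph D.carrier δ).Walk a₀ v), 0 < δ → η.IsPath →
      0 < (SAW.law D.carrier δ a₀ b₀).real
        {γ | ∃ q : (discreteDomainGraph D.carrier δ).Walk v b₀, γ.walk = η.append q} →
      ∀ z : Site 2, z ∉ η.support →
        let G := discreteDomainGraph D.carrier δ
        let S : Set (Site 2) := {w | w ∈ η.support ∧ w ≠ v}
        let Xη : Set (SAW.DomainSAW D.carrier δ a₀ b₀) := {γ | ∃ q : G.Walk v b₀, γ.walk = η.append q}
        let P' := SAW.edgeFugacityLaw G (fun _ _ => SAW.criticalFugacity) Sᶜ v b₀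
        (∫ γ in Xη, ((if s(z - ![1, 0], z) ∈ γ.walk.edges ∧ s(z, z + ![1, 0]) ∈ γ.walk.edges
              then (1 : ℝ) else 0) -
            (if s(z - ![0, 1], z) ∈ γ.walk.edges ∧ s(z, z + ![0, 1]) ∈ γ.walk.edges
              then (1 : ℝ) else 0)) ∂(SAW.law D.carrier δ a₀ b₀)) /
            (SAW.law D.carrier δ a₀ b₀).real Xη =
          ∫ (q : SAW.RestrictedSAW G Sᶜ v b₀),
            ((if s(z - ![1, 0], z) ∈ q.walk.edges ∧ s(z, z + ![1, 0]) ∈ q.walk.edges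
                then (1 : ℝ) else 0) -
              (if s(z - ![0, 1], z) ∈ q.walk.edges ∧ s(z, z + ![0, 1]) ∈ q.walk.edges
                then (1 : ℝ) else 0)) ∂P' ∧
        (∫ γ in Xη, ((if (s(z, z + ![1, 0]) ∈ γ.walk.edges ∧ s(z, z + ![0, 1]) ∈ γ.walk.edges) ∨
                (s(z - ![1, 0], z) ∈ γ.walk.edges ∧ s(z - ![0, 1], z) ∈ γ.walk.edges)
              then (1 : ℝ) else 0) -
            (if (s(z - ![1, 0], z) ∈ γ.walk.edges ∧ s(z, z + ![0, 1]) ∈ γ.walk.edges) ∨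
                (s(z, z + ![1, 0]) ∈ γ.walk.edges ∧ s(z - ![0, 1], z) ∈ γ.walk.edges)
              then (1 : ℝ) else 0)) ∂(SAW.law D.carrier δ a₀ b₀)) /
            (SAW.law D.carrier δ a₀ b₀).real Xη =
          ∫ (q : SAW.RestrictedSAW G Sᶜ v b₀),
            ((if (s(z, z + ![1, 0]) ∈ q.walk.edges ∧ s(z, z + ![0, 1]) ∈ q.walk.edges) ∨
                  (s(z - ![1, 0], z) ∈ q.walk.edges ∧ s(z - ![0, 1], z) ∈ q.walk.edges)
                then (1 : ℝ) else 0) -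
              (if (s(z - ![1, 0], z) ∈ q.walk.edges ∧ s(z, z + ![0, 1]) ∈ q.walk.edges) ∨
                  (s(z, z + ![1, 0]) ∈ q.walk.edges ∧ s(z - ![0, 1], z) ∈ q.walk.edges)
                then (1 : ℝ) else 0)) ∂P' := by
  sorry

/-- **STUB B1 · `stub_slitShapeB1`** (OPEN) `= SlitShapeB1`: one-amplitude shape of the AXIS quadrupole
one-point function of the unconditioned critical SAW in every slit domain `Ω_δ ∖ (η ∖ {v})`,
`= Re (D_z log G_b/G_v)²` up to `ε`. -/
theorem stub_slitShapeB1 :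
    ∃ A₁ : ℝ → ℝ, ∀ (D : DobrushinDomain) (a b : ℝ → Site 2), SAW.IsEndpointApprox D a b →
      let Gf : SimpleGraph (Site 2) → Site 2 → Site 2 → ℝ := fun Gr p q =>
        ∑' n : ℕ, (SRW.pathLaw 2).real {ω | (∀ j < n, Gr.Adj (p + SRW.S ω j) (p + SRW.S ω (j + 1))) ∧
          p + SRW.S ω n = q}
      ∀ ε > (0 : ℝ), ∀ ρ > (0 : ℝ), ∀ᶠ δ in nhdsWithin 0 (Set.Ioi 0),
        ∀ (v : Site 2) (η : (discreteDomainGraph D.carrier δ).Walk (a δ) v), η.IsPath →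
          0 < (SAW.law D.carrier δ (a δ) (b δ)).real
            {γ | ∃ q : (discreteDomainGraph D.carrier δ).Walk v (b δ), γ.walk = η.append q} →
          ∀ (z : Site 2), ρ ≤ Metric.infDist (meshPoint δ z) D.carrierᶜ →
            ρ ≤ dist (meshPoint δ z) (meshPoint δ (b δ)) →
            (∀ w ∈ η.support, ρ ≤ dist (meshPoint δ z) (meshPoint δ w)) →
            let G := discreteDomainGraph D.carrier δ
            let S : Set (Site 2) := {w | w ∈ η.support ∧ w ≠ v}
            let Gη : SimpleGraph (Site 2) := SimpleGraph.fromRel (fun x y => G.Adj x y ∧ x ∉ S ∧ y ∉ S)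
            let E₁ : ℝ := ∫ (q : SAW.RestrictedSAW G Sᶜ v (b δ)),
              ((if s(z - ![1, 0], z) ∈ q.walk.edges ∧ s(z, z + ![1, 0]) ∈ q.walk.edges
                  then (1 : ℝ) else 0) -
                (if s(z - ![0, 1], z) ∈ q.walk.edges ∧ s(z, z + ![0, 1]) ∈ q.walk.edges
                  then (1 : ℝ) else 0))
              ∂(SAW.edgeFugacityLaw G (fun _ _ => SAW.criticalFugacity) Sᶜ v (b δ))
            let L : Site 2 → ℝ := fun p => Real.log (Gf Gη p (b δ) / Gf Gη p v)
            let DL : ℂ := (((L (z + ![1, 0]) - L (z - ![1, 0]) : ℝ) : ℂ) -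
              Complex.I * ((L (z + ![0, 1]) - L (z - ![0, 1]) : ℝ) : ℂ)) / (4 * δ)
            |E₁ / A₁ δ - (DL ^ 2).re| ≤ ε := by
  sorry

/-- **STUB B2 · `stub_slitShapeB2`** (OPEN) `= SlitShapeB2`: the same for the DIAGONAL quadrupole and
`Im (D_z log G_b/G_v)²`. -/
theorem stub_slitShapeB2 :
    ∃ A₂ : ℝ → ℝ, ∀ (D : DobrushinDomain) (a b : ℝ → Site 2), SAW.IsEndpointApprox D a b →
      let Gf : SimpleGraph (Site 2) → Site 2 → Site 2 → ℝ := fun Gr p q =>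
        ∑' n : ℕ, (SRW.pathLaw 2).real {ω | (∀ j < n, Gr.Adj (p + SRW.S ω j) (p + SRW.S ω (j + 1))) ∧
          p + SRW.S ω n = q}
      ∀ ε > (0 : ℝ), ∀ ρ > (0 : ℝ), ∀ᶠ δ in nhdsWithin 0 (Set.Ioi 0),
        ∀ (v : Site 2) (η : (discreteDomainGraph D.carrier δ).Walk (a δ) v), η.IsPath →
          0 < (SAW.law D.carrier δ (a δ) (b δ)).real
            {γ | ∃ q : (discreteDomainGraph D.carrier δ).Walk v (b δ), γ.walk = η.append q} →
          ∀ (z : Site 2), ρ ≤ Metric.infDist (meshPoint δ z) D.carrierᶜ →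
            ρ ≤ dist (meshPoint δ z) (meshPoint δ (b δ)) →
            (∀ w ∈ η.support, ρ ≤ dist (meshPoint δ z) (meshPoint δ w)) →
            let G := discreteDomainGraph D.carrier δ
            let S : Set (Site 2) := {w | w ∈ η.support ∧ w ≠ v}
            let Gη : SimpleGraph (Site 2) := SimpleGraph.fromRel (fun x y => G.Adj x y ∧ x ∉ S ∧ y ∉ S)
            let E₂ : ℝ := ∫ (q : SAW.RestrictedSAW G Sᶜ v (b δ)),
              ((if (s(z, z + ![1, 0]) ∈ q.walk.edges ∧ s(z, z + ![0, 1]) ∈ q.walk.edges) ∨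
                    (s(z - ![1, 0], z) ∈ q.walk.edges ∧ s(z - ![0, 1], z) ∈ q.walk.edges)
                  then (1 : ℝ) else 0) -
                (if (s(z - ![1, 0], z) ∈ q.walk.edges ∧ s(z, z + ![0, 1]) ∈ q.walk.edges) ∨
                    (s(z, z + ![1, 0]) ∈ q.walk.edges ∧ s(z - ![0, 1], z) ∈ q.walk.edges)
                  then (1 : ℝ) else 0))
              ∂(SAW.edgeFugacityLaw G (fun _ _ => SAW.criticalFugacity) Sᶜ v (b δ))
            let L : Site 2 → ℝ := fun p => Real.log (Gf Gη p (b δ) / Gf Gη p v)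
            let DL : ℂ := (((L (z + ![1, 0]) - L (z - ![1, 0]) : ℝ) : ℂ) -
              Complex.I * ((L (z + ![0, 1]) - L (z - ![0, 1]) : ℝ) : ℂ)) / (4 * δ)
            |E₂ / A₂ δ - (DL ^ 2).im| ≤ ε := by
  sorry

/-! ### Consistency: each named statement IS its registered stub (definitionally) -/

theorem domainMarkov_holds : DomainMarkov := stub_domainMarkov
theorem slitShapeB1_holds : SlitShapeB1 := stub_slitShapeB1
theorem slitShapeB2_holds : SlitShapeB2 := stub_slitShapeB2

/-! ### Name-keyed aliases of the three statements (the hypotheses of the composition) -/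
namespace Registered

/-- Alias of `DomainMarkov` keyed by the registered stub name. -/
abbrev stub_domainMarkov : Prop := DomainMarkov
/-- Alias of `SlitShapeB1` keyed by the registered stub name. -/
abbrev stub_slitShapeB1 : Prop := SlitShapeB1
/-- Alias of `SlitShapeB2` keyed by the registered stub name. -/
abbrev stub_slitShapeB2 : Prop := SlitShapeB2

end Registered

/-! ## §3 The composition: the three stubs imply the crux, BY NAME (kernel-checked; no `sorry` below).
Not a one-line seam: the amplitudes are assembled from the two channels, the mesh filter events are
intersected with `δ > 0`, `z ∉ η` is extracted from the `ρ`-separation, and both conditional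
expectations of the crux are converted into slit-law expectations by the domain Markov identity. -/

/-- **`SlitQuadrupoleShape_of`** — STUBS DM, B1, B2 imply `SAWStressTensor.SlitQuadrupoleShape`. -/
theorem SlitQuadrupoleShape_of (hM : Registered.stub_domainMarkov)
    (h1 : Registered.stub_slitShapeB1) (h2 : Registered.stub_slitShapeB2) :
    SlitQuadrupoleShape := by
  obtain ⟨A₁, hA₁⟩ := h1
  obtain ⟨A₂, hA₂⟩ := h2
  refine ⟨A₁, A₂, ?_⟩
  intro D a b hab
  dsimp only
  intro ε hε ρ hρ
  have e1 := hA₁ D a b hab ε hε ρ hρ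
  have e2 := hA₂ D a b hab ε hε ρ hρ
  filter_upwards [e1, e2, self_mem_nhdsWithin] with δ hδ1 hδ2 hδpos
  intro v η hη hpos z hz1 hz2 hz3
  -- `z` is off the prefix: a vertex of `η` at `z` would be at distance `0 < ρ` from itself
  have hzη : z ∉ η.support := fun hz => by
    have h := hz3 z hz
    rw [dist_self] at h
    exact absurd h (not_le.mpr hρ)
  -- domain Markov at this `δ > 0`, and the two channel estimates
  have hD := hM D δ (a δ) (b δ) v η hδpos hη hpos z hzη
  have k1 := hδ1 v η hη hpos z hz1 hz2 hz3
  have k2 := hδ2 v η hη hpos z hz1 hz2 hz3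
  dsimp only at hD k1 k2
  rw [hD.1, hD.2]
  exact ⟨k1, k2⟩

/-- Wiring check: the registered stubs feed `SlitQuadrupoleShape_of` as stated (this term becomes the
crux proof once the three `sorry`s above are discharged). -/
example : SlitQuadrupoleShape :=
  SlitQuadrupoleShape_of stub_domainMarkov stub_slitShapeB1 stub_slitShapeB2

end Summit.CriticalPhenomena.SAWScalingLimit.Cruxes.SlitQuadrupoleShape.Birth

end
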